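import Summits.AtomisticToContinuum.BoseEinsteinCondensation.Theorems.BECGroundStateSOSPeriodicIRBoundDefs
import Summits.AtomisticToContinuum.BoseEinsteinCondensation.Theorems.BECGroundStateSOSPeriodicIRBoundWFDefs
import Summits.AtomisticToContinuum.BoseEinsteinCondensation.Theorems.BECGroundStateSOSPeriodicIRBoundWFPotToolkit
import Summits.AtomisticToContinuum.BoseEinsteinCondensation.Theorems.BECGroundStateSOSPeriodicIRBoundWFRegularity
import Summits.AtomisticToContinuum.BoseEinsteinCondensation.Theorems.BECGroundStateSOSPeriodicIRBoundWFPotCross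
import Literature.MathematicalPhysics.QuantumManyBody.PeriodicBoseGasMomentumSector
import Literature.MathematicalPhysics.QuantumManyBody.TorusFockLayer
import Literature.MathematicalPhysics.QuantumManyBody.TorusFockSectorInteraction
import Literature.MathematicalPhysics.QuantumManyBody.PeriodicFormDomain
import Literature.MathematicalPhysics.QuantumManyBody.PeriodicBoseGasTagged
import Mathlib.MeasureTheory.Integral.Bochner.ContinuousLinearMap
import HarnessLib

/-! # Crux `PeriodicIRBound` (stmt-AtomisticToContinuum-3972), line `linear-ph-floor-wagner`, stub 5b `stub_wagnerFeynman` — PotCreate2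
The potential of the particle state, part 2: peeling tools and the four pieces of the exchange pair integral. -/

/-!

With `φ = planeWaveMode L k`, `h = sliceCoef L k Φ`, `W = periodicInteraction w L` and the bounded factor
`B(Z) = conj(φ(Z 1) Φ(Z without 1)) · φ(Z 0) Φ(Z without 0)` (`exchFactor`), part 1 reduced `P[a†Φ].toReal` to the
direct term plus `(m+1) Re ∫_{Λ^{m+2}} W.toReal · B`. Splitting `W(Z) = w^per(Z₀-Z₁) + ∑_b w^per(Z₀-Z_{b+2}) +
∑_b w^per(Z₁-Z_{b+2}) + W(Z₂,…)` (part 3), each piece `∫ V.toReal · B` (integrable: `V ≤ W ∈ L¹(Λ^{m+2})`, `B`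
bounded continuous) is computed by peeling the first particle twice (TK1; the integrability of the slice
integral is transported by `integrableOn_integral_vecCons`, so no parametric measurability is needed):

* `piece_pair`: `∫ w^per(Z₀-Z₁) B = E` (`exchCoef`); `piece_zeroSpect`: `∫ w^per(Z₀-Z_{b+2}) B = s_b` (`mixCoef`);
* `piece_oneSpect`: `∫ w^per(Z₁-Z_{b+2}) B = conj(s_b)`; `piece_tailTail`: `∫ W(Z₂,…) B = ∫_{Λ^m} W.toReal |h|²`.

Also the general tools (`integrable_vecCons_prod`, `integrableOn_integral_vecCons`, `integrable_toReal_mul_of_bdd`, …).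
-/

noncomputable section

open scoped BigOperators ENNReal ComplexConjugate
open Filter MeasureTheory

namespace Summit.AtomisticToContinuum.BoseEinsteinCondensation.Cruxes.PeriodicIRBound.LinearPhFloorWagner.WF

open Literature.MathematicalPhysics.QuantumManyBody.BoseGas

variable {M m n : ℕ} {L : ℝ}

/-! ## General tools: tuples, measurability, integrability transport -/

/-- The inverse of the split `Λ^{m+1} ≃ Λ × Λ^m` at slot `0` is `(x, Y) ↦ x :: Y`. [folklore] -/
private theorem piFinSuccAbove_zero_symm_apply (p : Space × Config m) :
    (MeasurableEquiv.piFinSuccAbove (fun _ : Fin (m + 1) => Space) 0).symm p = Matrix.vecCons p.1 p.2 := by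
  change Fin.insertNth 0 p.1 p.2 = (Fin.cons p.1 p.2 : Config (m + 1))
  exact Fin.insertNth_zero' p.1 p.2

/-- Transport of integrability on `Λ^{m+1}` to the split coordinates `(x, Y) ↦ x :: Y` on `Λ × Λ^m`
(`measurePreserving_piFinSuccAbove_cellN`). [folklore] -/
private theorem integrable_vecCons_prod {F : Config (m + 1) → ℂ} (hF : IntegrableOn F (cellN (m + 1) L) volume) :
    Integrable (fun p : Space × Config m => F (Matrix.vecCons p.1 p.2))
      (((volume : Measure Space).restrict (cell L)).prod
        ((volume : Measure (Config m)).restrict (cellN m L))) := by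
  set e := MeasurableEquiv.piFinSuccAbove (fun _ : Fin (m + 1) => Space) 0 with he_def
  have he := (measurePreserving_piFinSuccAbove_cellN (n := m) 0 L).symm e
  have hfun : (F ∘ e.symm) = fun p : Space × Config m => F (Matrix.vecCons p.1 p.2) := by
    funext p
    rw [Function.comp_apply, piFinSuccAbove_zero_symm_apply]
  rw [← hfun]
  exact (he.integrable_comp_emb e.symm.measurableEmbedding).mpr hF

/-- **Fubini bookkeeping**: if `F` is integrable on `Λ^{m+1}` then the slice integral `Y ↦ ∫_Λ F(x :: Y) dx` is
integrable on `Λ^m` (`Integrable.integral_prod_right`). [folklore] -/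
private theorem integrableOn_integral_vecCons {F : Config (m + 1) → ℂ} (hF : IntegrableOn F (cellN (m + 1) L) volume) :
    IntegrableOn (fun Y : Config m => ∫ x in cell L, F (Matrix.vecCons x Y)) (cellN m L) volume :=
  (integrable_vecCons_prod hF).integral_prod_right

/-- Dropping a particle keeps a configuration in the cell. [folklore] -/
theorem removeNth_mem_cellN {Z : Config (m + 1)} (hZ : Z ∈ cellN (m + 1) L) (j : Fin (m + 1)) :
    j.removeNth Z ∈ cellN m L := fun i => hZ (j.succAbove i)

/-- `tail (x :: Y) = Y`. [folklore] -/
private theorem tail_vecCons (x : Space) (Y : Config m) : Fin.tail (Matrix.vecCons x Y : Config (m + 1)) = Y :=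
  Fin.tail_cons (α := fun _ : Fin (m + 1) => Space) x Y

/-- `(x :: Y) without particle 1 = x :: tail Y`. [folklore] -/
private theorem removeNth_one_vecCons (x : Space) (Y : Config (m + 1)) :
    Fin.removeNth 1 (Matrix.vecCons x Y : Config (m + 2)) = Matrix.vecCons x (Fin.tail Y) := by
  rw [← Fin.succ_zero_eq_one, removeNth_succ_vecCons, Fin.removeNth_zero]

/-- `Z ↦ tail Z` is continuous. [folklore] -/
private theorem continuous_tail : Continuous fun Z : Config (M + 1) => Fin.tail Z :=
  continuous_pi fun i => continuous_apply i.succ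

/-- `Z ↦ tail Z` is measurable. [folklore] -/
theorem measurable_tail : Measurable fun Z : Config (M + 1) => Fin.tail Z :=
  measurable_pi_lambda _ fun _ => measurable_pi_apply _

/-- One pair is dominated by the whole interaction: `w^per(Z i - Z j) ≤ W(Z)` for `i < j`. [folklore] -/
theorem periodizedPotential_le_periodicInteraction (w : ℝ → ℝ≥0∞) (L : ℝ) (Z : Config M) {i j : Fin M}
    (hij : i < j) : periodizedPotential w L (Z i - Z j) ≤ periodicInteraction w L Z := by
  unfold periodicInteraction
  calc periodizedPotential w L (Z i - Z j)
      ≤ ∑ j' : Fin M with i < j', periodizedPotential w L (Z i - Z j') :=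
        Finset.single_le_sum (f := fun j' => periodizedPotential w L (Z i - Z j')) (fun _ _ => zero_le)
          (Finset.mem_filter.2 ⟨Finset.mem_univ _, hij⟩)
    _ ≤ ∑ i' : Fin M, ∑ j' : Fin M with i' < j', periodizedPotential w L (Z i' - Z j') :=
        Finset.single_le_sum (f := fun i' => ∑ j' : Fin M with i' < j', periodizedPotential w L (Z i' - Z j'))
          (fun _ _ => zero_le) (Finset.mem_univ i)

/-- Dropping the first particle's pairs: `W(tail Z) ≤ W(Z)`. [folklore] -/
theorem periodicInteraction_tail_le (w : ℝ → ℝ≥0∞) (L : ℝ) (Z : Config (M + 1)) :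
    periodicInteraction w L (Fin.tail Z) ≤ periodicInteraction w L Z := by
  rw [periodicInteraction_succ w L Z]
  exact le_add_self

/-- **Integrability against a dominated weight**: for a measurable weight `V` with `∫_{Λ^M} V < ∞` and an
a.e.-strongly measurable factor `B` bounded on `Λ^M`, `V.toReal · B` is integrable on `Λ^M`. [folklore] -/
private theorem integrable_toReal_mul_of_bdd {V : Config M → ℝ≥0∞} (hV : Measurable V)
    (hVi : ∫⁻ X in cellN M L, V X ≠ ⊤) {B : Config M → ℂ}
    (hB : AEStronglyMeasurable B ((volume : Measure (Config M)).restrict (cellN M L))) {C : ℝ}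
    (hC : ∀ X ∈ cellN M L, ‖B X‖ ≤ C) :
    Integrable (fun X => ((V X).toReal : ℂ) * B X) ((volume : Measure (Config M)).restrict (cellN M L)) :=
  Integrable.mul_bdd (integrable_toReal_of_lintegral_ne_top hV.aemeasurable hVi).ofReal hB
    (ae_restrict_of_forall_mem (measurableSet_cellN M L) hC)

/-! ## The slice coefficient -/

/-- `h = (√(m+1))⁻¹ aΦ`. [folklore] -/
theorem sliceCoef_eq_modeAn (L : ℝ) (k : Fin 3 → ℤ) (Φ : Config (m + 1) → ℂ) (Y : Config m) :
    sliceCoef L k Φ Y = ((Real.sqrt (m + 1) : ℝ) : ℂ)⁻¹ * modeAn L (planeWaveMode L k) Φ Y := by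
  rw [modeAn_apply, inv_mul_cancel_left₀ (sqrt_cast_ne_zero m)]
  rfl

/-! ## The bounded factor and the pieces -/

/-- The bounded factor `B(Z) = conj(c_1(Z)) c_0(Z)`, `c_j(Z) = φ(Z j) Φ(Z without j)`. -/
def exchFactor (L : ℝ) (k : Fin 3 → ℤ) (Φ : Config (m + 1) → ℂ) (Z : Config (m + 2)) : ℂ :=
  conj (planeWaveMode L k (Z 1) * Φ (Fin.removeNth 1 Z)) * (planeWaveMode L k (Z 0) * Φ (Fin.removeNth 0 Z))

/-- `B` is continuous. [folklore] -/
theorem continuous_exchFactor (L : ℝ) (k : Fin 3 → ℤ) {Φ : Config (m + 1) → ℂ} (hΦ : Continuous Φ) :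
    Continuous (exchFactor L k Φ) := by
  unfold exchFactor
  have hφ := continuous_planeWaveMode L k
  exact (Complex.continuous_conj.comp ((hφ.comp (continuous_apply 1)).mul
    (hΦ.comp (continuous_removeNth 1)))).mul ((hφ.comp (continuous_apply 0)).mul (hΦ.comp (continuous_removeNth 0)))

/-- `|B| ≤ L⁻³ ‖Φ‖_∞²` on `Λ^{m+2}`. [folklore] -/
theorem norm_exchFactor_le {k : Fin 3 → ℤ} {Φ : Config (m + 1) → ℂ} {C : ℝ} (hC : ∀ X ∈ cellN (m + 1) L, ‖Φ X‖ ≤ C)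
    {Z : Config (m + 2)} (hZ : Z ∈ cellN (m + 2) L) :
    ‖exchFactor L k Φ Z‖ ≤ (Real.sqrt (L ^ 3))⁻¹ * C * ((Real.sqrt (L ^ 3))⁻¹ * C) := by
  unfold exchFactor
  rw [norm_mul, Complex.norm_conj, norm_mul, norm_mul, norm_planeWaveMode, norm_planeWaveMode]
  have h1 := hC _ (removeNth_mem_cellN hZ 1)
  have h0 := hC _ (removeNth_mem_cellN hZ 0)
  have hC0 : 0 ≤ C := (norm_nonneg _).trans h0
  gcongr

/-- `B(x :: Y) = conj(φ(Y 0) Φ(x :: tail Y)) φ(x) Φ(Y)`. [folklore] -/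
theorem exchFactor_vecCons (L : ℝ) (k : Fin 3 → ℤ) (Φ : Config (m + 1) → ℂ) (x : Space) (Y : Config (m + 1)) :
    exchFactor L k Φ (Matrix.vecCons x Y) =
      conj (planeWaveMode L k (Y 0) * Φ (Matrix.vecCons x (Fin.tail Y))) * (planeWaveMode L k x * Φ Y) := by
  rw [exchFactor, Matrix.cons_val_one, Matrix.cons_val_zero, removeNth_one_vecCons, removeNth_zero_vecCons]

/-- The inner `x`-integral against an `x`-independent weight:
`∫_x r B(x :: Y) = r conj φ(Y 0) Φ(Y) conj h(tail Y)`. [folklore] -/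
theorem integral_mul_exchFactor_vecCons (L : ℝ) (k : Fin 3 → ℤ) (Φ : Config (m + 1) → ℂ) (r : ℂ)
    (Y : Config (m + 1)) :
    ∫ x in cell L, r * exchFactor L k Φ (Matrix.vecCons x Y) =
      r * (conj (planeWaveMode L k (Y 0)) * Φ Y * conj (sliceCoef L k Φ (Fin.tail Y))) := by
  have hpt : ∀ x : Space, r * exchFactor L k Φ (Matrix.vecCons x Y) =
      r * (conj (planeWaveMode L k (Y 0)) * Φ Y) *
        conj (conj (planeWaveMode L k x) * Φ (Matrix.vecCons x (Fin.tail Y))) := by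
    intro x
    rw [exchFactor_vecCons]
    simp only [map_mul, Complex.conj_conj]
    ring
  simp_rw [hpt]
  rw [integral_const_mul, integral_conj]
  simp only [sliceCoef]
  ring

/-- Every piece `V.toReal · B` with `V ≤ W` measurable is integrable on `Λ^{m+2}`. [folklore] -/
theorem integrable_piece (hL : 0 < L) {w : ℝ → ℝ≥0∞} (hw : Measurable w) (hint : (∫⁻ z : Space, w ‖z‖) ≠ ⊤)
    (k : Fin 3 → ℤ) {Φ : Config (m + 1) → ℂ} (hΦ : Continuous Φ) {V : Config (m + 2) → ℝ≥0∞} (hV : Measurable V)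
    (hVW : ∀ Z, V Z ≤ periodicInteraction w L Z) :
    Integrable (fun Z => ((V Z).toReal : ℂ) * exchFactor L k Φ Z)
      ((volume : Measure (Config (m + 2))).restrict (cellN (m + 2) L)) := by
  obtain ⟨C, _, hC⟩ := exists_bound_on_cellN L hΦ
  exact integrable_toReal_mul_of_bdd hV
    (ne_top_of_le_ne_top (lintegral_cellN_periodicInteraction_ne_top hL hw hint (m + 2)) (lintegral_mono fun Z => hVW Z))
    (continuous_exchFactor L k hΦ).aestronglyMeasurable (fun Z hZ => norm_exchFactor_le hC hZ)

/-! ### Weights through `tail Z`: the direct-type piece and the `conj s_b` pieces -/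

/-- First peel for a weight depending on `tail Z` only:
`∫_Z U(tail Z) B(Z) = ∫_Y U(Y) conj φ(Y 0) Φ(Y) conj h(tail Y)`. [folklore] -/
theorem integral_tailWeight_mul_exchFactor (hL : 0 < L) {w : ℝ → ℝ≥0∞} (hw : Measurable w)
    (hint : (∫⁻ z : Space, w ‖z‖) ≠ ⊤) (k : Fin 3 → ℤ) {Φ : Config (m + 1) → ℂ} (hΦ : Continuous Φ)
    {U : Config (m + 1) → ℝ≥0∞} (hU : Measurable U) (hUW : ∀ Y, U Y ≤ periodicInteraction w L Y) :
    ∫ Z in cellN (m + 2) L, ((U (Fin.tail Z)).toReal : ℂ) * exchFactor L k Φ Z =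
      ∫ Y in cellN (m + 1) L, ((U Y).toReal : ℂ) *
        (conj (planeWaveMode L k (Y 0)) * Φ Y * conj (sliceCoef L k Φ (Fin.tail Y))) := by
  have hV : Measurable fun Z : Config (m + 2) => U (Fin.tail Z) := hU.comp measurable_tail
  have hVW : ∀ Z : Config (m + 2), U (Fin.tail Z) ≤ periodicInteraction w L Z := fun Z =>
    (hUW _).trans (periodicInteraction_tail_le w L Z)
  rw [integral_cellN_succ L (integrable_piece hL hw hint k hΦ hV hVW)]
  refine integral_congr_ae (Eventually.of_forall fun Y => ?_)
  dsimp only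
  rw [← integral_mul_exchFactor_vecCons L k Φ _ Y]
  refine integral_congr_ae (Eventually.of_forall fun x => ?_)
  dsimp only
  rw [tail_vecCons]

/-- The `Y`-integrand after the first peel, `U(Y) conj φ(Y 0) Φ(Y) conj h(tail Y)`, is integrable on `Λ^{m+1}`
for `U ≤ W`. [folklore] -/
theorem integrable_weight_mul_sliceFactor (hL : 0 < L) {w : ℝ → ℝ≥0∞} (hw : Measurable w)
    (hint : (∫⁻ z : Space, w ‖z‖) ≠ ⊤) (k : Fin 3 → ℤ) {Φ : Config (m + 1) → ℂ} (hΦ : Continuous Φ)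
    {U : Config (m + 1) → ℝ≥0∞} (hU : Measurable U) (hUW : ∀ Y, U Y ≤ periodicInteraction w L Y) :
    Integrable (fun Y : Config (m + 1) => ((U Y).toReal : ℂ) *
        (conj (planeWaveMode L k (Y 0)) * Φ Y * conj (sliceCoef L k Φ (Fin.tail Y))))
      ((volume : Measure (Config (m + 1))).restrict (cellN (m + 1) L)) := by
  obtain ⟨C, hC0, hC⟩ := exists_bound_on_cellN L hΦ
  obtain ⟨D, hD0, hD⟩ := exists_bound_on_cellN L (PotCross.continuous_sliceCoef L k hΦ)
  have hcont : Continuous fun Y : Config (m + 1) =>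
      conj (planeWaveMode L k (Y 0)) * Φ Y * conj (sliceCoef L k Φ (Fin.tail Y)) :=
    ((Complex.continuous_conj.comp ((continuous_planeWaveMode L k).comp (continuous_apply 0))).mul hΦ).mul
      (Complex.continuous_conj.comp ((PotCross.continuous_sliceCoef L k hΦ).comp continuous_tail))
  refine integrable_toReal_mul_of_bdd hU
    (ne_top_of_le_ne_top (lintegral_cellN_periodicInteraction_ne_top hL hw hint (m + 1)) (lintegral_mono fun Y => hUW Y))
    hcont.aestronglyMeasurable (C := (Real.sqrt (L ^ 3))⁻¹ * C * D) (fun Y hY => ?_)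
  rw [norm_mul, norm_mul, Complex.norm_conj, Complex.norm_conj, norm_planeWaveMode]
  have h1 := hC Y hY
  have h2 := hD (Fin.tail Y) (fun i => hY i.succ)
  gcongr

/-- **Piece `W(Z₂,…)`**: `∫_Z W(tail tail Z) B = ∫_{Λ^m} W.toReal |h|²` (as a real number cast to `ℂ`). -/
theorem piece_tailTail (hL : 0 < L) {w : ℝ → ℝ≥0∞} (hw : Measurable w) (hint : (∫⁻ z : Space, w ‖z‖) ≠ ⊤)
    (k : Fin 3 → ℤ) {Φ : Config (m + 1) → ℂ} (hΦ : Continuous Φ) :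
    ∫ Z in cellN (m + 2) L, ((periodicInteraction w L (Fin.tail (Fin.tail Z))).toReal : ℂ) * exchFactor L k Φ Z =
      ((∫ Y in cellN m L, (periodicInteraction w L Y).toReal * ‖sliceCoef L k Φ Y‖ ^ 2 : ℝ) : ℂ) := by
  have hU : Measurable fun Y : Config (m + 1) => periodicInteraction w L (Fin.tail Y) :=
    (measurable_periodicInteraction_tk hw L).comp measurable_tail
  have hUW : ∀ Y : Config (m + 1), periodicInteraction w L (Fin.tail Y) ≤ periodicInteraction w L Y := fun Y =>
    periodicInteraction_tail_le w L Y
  refine (integral_tailWeight_mul_exchFactor hL hw hint k hΦ hU hUW).trans ?_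
  rw [integral_cellN_succ L (integrable_weight_mul_sliceFactor hL hw hint k hΦ hU hUW), ← integral_complex_ofReal]
  refine integral_congr_ae (Eventually.of_forall fun W' => ?_)
  dsimp only
  have hpt : ∀ y : Space, ((periodicInteraction w L (Fin.tail (Matrix.vecCons y W' : Config (m + 1)))).toReal : ℂ) *
      (conj (planeWaveMode L k ((Matrix.vecCons y W' : Config (m + 1)) 0)) * Φ (Matrix.vecCons y W') *
        conj (sliceCoef L k Φ (Fin.tail (Matrix.vecCons y W' : Config (m + 1))))) =
      ((periodicInteraction w L W').toReal : ℂ) * conj (sliceCoef L k Φ W') *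
        (conj (planeWaveMode L k y) * Φ (Matrix.vecCons y W')) := by
    intro y
    rw [tail_vecCons, Matrix.cons_val_zero]
    ring
  simp_rw [hpt]
  rw [integral_const_mul]
  change ((periodicInteraction w L W').toReal : ℂ) * conj (sliceCoef L k Φ W') * sliceCoef L k Φ W' = _
  rw [mul_assoc, Complex.conj_mul']
  push_cast
  ring

/-- **Piece `w^per(Z₁ - Z_{b+2})`**: `∫_Z w^per(Z₁-Z_{b+2}) B = conj(s_b)`. -/
theorem piece_oneSpect (hL : 0 < L) {w : ℝ → ℝ≥0∞} (hw : Measurable w) (hint : (∫⁻ z : Space, w ‖z‖) ≠ ⊤)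
    (k : Fin 3 → ℤ) {Φ : Config (m + 1) → ℂ} (hΦ : Continuous Φ) (b : Fin m) :
    ∫ Z in cellN (m + 2) L, ((periodizedPotential w L (Z 1 - Z b.succ.succ)).toReal : ℂ) * exchFactor L k Φ Z =
      conj (mixCoef w L k Φ b) := by
  have hU : Measurable fun Y : Config (m + 1) => periodizedPotential w L (Y 0 - Y b.succ) :=
    measurable_periodizedPotential_pair hw L 0 b.succ
  have hUW : ∀ Y : Config (m + 1), periodizedPotential w L (Y 0 - Y b.succ) ≤ periodicInteraction w L Y := fun Y =>
    periodizedPotential_le_periodicInteraction w L Y (Fin.succ_pos b)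
  refine (integral_tailWeight_mul_exchFactor hL hw hint k hΦ hU hUW).trans ?_
  rw [integral_cellN_succ L (integrable_weight_mul_sliceFactor hL hw hint k hΦ hU hUW), mixCoef,
    ← integral_conj]
  refine integral_congr_ae (Eventually.of_forall fun W' => ?_)
  dsimp only
  rw [← integral_conj]
  refine integral_congr_ae (Eventually.of_forall fun y => ?_)
  simp only [map_mul, Complex.conj_conj, Complex.conj_ofReal, Matrix.cons_val_zero, Matrix.cons_val_succ,
    tail_vecCons]
  ring

/-! ### Weights through particle `0`: the `s_b` pieces and the exchange piece -/

/-- **Piece `w^per(Z₀ - Z_{b+2})`**: `∫_Z w^per(Z₀-Z_{b+2}) B = s_b`. -/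
theorem piece_zeroSpect (hL : 0 < L) {w : ℝ → ℝ≥0∞} (hw : Measurable w) (hint : (∫⁻ z : Space, w ‖z‖) ≠ ⊤)
    (k : Fin 3 → ℤ) {Φ : Config (m + 1) → ℂ} (hΦ : Continuous Φ) (b : Fin m) :
    ∫ Z in cellN (m + 2) L, ((periodizedPotential w L (Z 0 - Z b.succ.succ)).toReal : ℂ) * exchFactor L k Φ Z =
      mixCoef w L k Φ b := by
  have hV : Measurable fun Z : Config (m + 2) => periodizedPotential w L (Z 0 - Z b.succ.succ) :=
    measurable_periodizedPotential_pair hw L 0 b.succ.succ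
  have hVW : ∀ Z : Config (m + 2), periodizedPotential w L (Z 0 - Z b.succ.succ) ≤ periodicInteraction w L Z :=
    fun Z => periodizedPotential_le_periodicInteraction w L Z (Fin.succ_pos _)
  have hF := integrable_piece hL hw hint k hΦ hV hVW
  rw [integral_cellN_succ L hF, integral_cellN_succ L (integrableOn_integral_vecCons hF), mixCoef]
  refine integral_congr_ae (Eventually.of_forall fun W' => ?_)
  dsimp only
  have hpt : ∀ y x : Space,
      ((periodizedPotential w L ((Matrix.vecCons x (Matrix.vecCons y W') : Config (m + 2)) 0 -
          (Matrix.vecCons x (Matrix.vecCons y W') : Config (m + 2)) b.succ.succ)).toReal : ℂ) *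
        exchFactor L k Φ (Matrix.vecCons x (Matrix.vecCons y W')) =
      conj (planeWaveMode L k y) * Φ (Matrix.vecCons y W') *
        (((periodizedPotential w L (x - W' b)).toReal : ℂ) *
          (conj (Φ (Matrix.vecCons x W')) * planeWaveMode L k x)) := by
    intro y x
    rw [exchFactor_vecCons]
    simp only [Matrix.cons_val_zero, Matrix.cons_val_succ, tail_vecCons, map_mul]
    ring
  simp_rw [hpt]
  simp_rw [integral_const_mul]
  rw [integral_mul_const]
  change sliceCoef L k Φ W' * _ = _
  rw [mul_comm, ← integral_mul_const]
  refine integral_congr_ae (Eventually.of_forall fun x => ?_)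
  dsimp only
  ring

/-- **Piece `w^per(Z₀ - Z₁)`**: `∫_Z w^per(Z₀-Z₁) B = E` (the two peels come out in the order of `exchCoef`; `w^per` is even). -/
theorem piece_pair (hL : 0 < L) {w : ℝ → ℝ≥0∞} (hw : Measurable w) (hint : (∫⁻ z : Space, w ‖z‖) ≠ ⊤)
    (k : Fin 3 → ℤ) {Φ : Config (m + 1) → ℂ} (hΦ : Continuous Φ) :
    ∫ Z in cellN (m + 2) L, ((periodizedPotential w L (Z 0 - Z 1)).toReal : ℂ) * exchFactor L k Φ Z =
      exchCoef w L k Φ := by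
  have hV : Measurable fun Z : Config (m + 2) => periodizedPotential w L (Z 0 - Z 1) :=
    measurable_periodizedPotential_pair hw L 0 1
  have hVW : ∀ Z : Config (m + 2), periodizedPotential w L (Z 0 - Z 1) ≤ periodicInteraction w L Z :=
    fun Z => periodizedPotential_le_periodicInteraction w L Z Fin.zero_lt_one
  have hF := integrable_piece hL hw hint k hΦ hV hVW
  rw [integral_cellN_succ L hF, integral_cellN_succ L (integrableOn_integral_vecCons hF), exchCoef]
  refine integral_congr_ae (Eventually.of_forall fun W' => ?_)
  refine integral_congr_ae (Eventually.of_forall fun y => ?_)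
  refine integral_congr_ae (Eventually.of_forall fun x => ?_)
  dsimp only
  rw [exchFactor_vecCons]
  simp only [Matrix.cons_val_zero, Matrix.cons_val_one, tail_vecCons, map_mul]
  rw [periodizedPotential_sub_comm]
  ring

end Summit.AtomisticToContinuum.BoseEinsteinCondensation.Cruxes.PeriodicIRBound.LinearPhFloorWagner.WF

end

namespace Summit.AtomisticToContinuum.BoseEinsteinCondensation.Cruxes.PeriodicIRBound.LinearPhFloorWagner

/-- The registered sub-goal `stub_wfPotCreate2` of the crux ledger: this file's headline lemma `WF.sliceCoef_eq_modeAn`. -/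
theorem stub_wfPotCreate2 : WF.Pkg.PotCreate2 :=
  @WF.sliceCoef_eq_modeAn

end Summit.AtomisticToContinuum.BoseEinsteinCondensation.Cruxes.PeriodicIRBound.LinearPhFloorWagner
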